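import Literature.NumberTheory.EllipticCurves.QuadraticTwistIrreducibleModPFieldProofs
import Literature.NumberTheory.EllipticCurves.BSDSelmerSkinnerThmBProofs
import Literature.NumberTheory.EllipticCurves.LFunctionSmulProofs
import Literature.NumberTheory.EllipticCurves.CuspFormLFunction
import Literature.NumberTheory.EllipticCurves.QuadraticTwistJInvariantProofs
import HarnessLib

/-!
# Route ByReductionTypeAtTwo, crux C4″ `AdditivePotMultOverKAtTwo` (stmt-BirchSwinnertonDyer-22618) — R15 DICTIONARY:
# the (−2)-block data of `W` are the (−1)-block data of any `ℚ`-model `W₂` of `W^{(2)}`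

Seat `bsd-2adic-t42` GEN 22 (cell `bsd-2adic`); companion of `…AdditiveSelmerTwistTransport{,Doors}.lean` (the Selmer side
of R15). HONEST FRAMING: THEOREMS ONLY; route-independent; closes no item; nothing booked; BSD is not proved by any of this.

For `V • W₂ = W^{(2)}` (k4-w3 GEN 0's R15 with the twist replaced by an arbitrary `ℚ`-MODEL, e.g. the globally minimal one
that the (−1)-block doors want):
* `exists_variableChange_smul_twistNegOne_eq` — `W₂^{(−1)} ≅_ℚ W^{(−2)}` (`(V • W₂)^{(−1)} = (u, −r, 0, 0) • W₂^{(−1)}`,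
  `quadraticTwist_smul`; `(W^{(2)})^{(−1)} = W^{(−2)}`, `quadraticTwist_quadraticTwist`);
* **`hasSplitMultiplicativeReductionAtPrime_twistNegOne_model_iff`** — `W₂^{(−1)}` is split multiplicative at `2` iff
  `W^{(−2)}` is (so `W₂` is in the (−1)-block iff `W` is in the (−2)-block);
* **`isNewformOf_twistNegOne_model_iff`** — `f` is the newform of `W₂^{(−1)}` iff it is the newform of `W^{(−2)}` (same
  `L`-function: `WeierstrassCurve.LFunction_smul`);
* **`hasIrreducibleModPGaloisRep_model`** / `…_iff` — `W₂[p]` irreducible iff `W[p]` irreducible (tree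
  `hasIrreducibleModPGaloisRep_of_smul_eq_quadraticTwist_of_field`, twists do not move `E[p]`-lines).

References: [SilvermanAEC2009] X.2 Prop. 2.4, X.5 Cor. 5.4, App. C §16; [Kato2004Asterisque] §17.13 (the data of the doors).
-/

set_option autoImplicit false
-- the summit's namespace `Summit.BirchSwinnertonDyer.BirchSwinnertonDyer` (Sub = Summit) trips `dupNamespace`
set_option linter.dupNamespace false

noncomputable section

open scoped Classical

namespace Summit.BirchSwinnertonDyer.BirchSwinnertonDyer.Theorems.AddSelmerTwistTwo

open WeierstrassCurve Literature.NumberTheory.EllipticCurves Literature.NumberTheory.EllipticCurves.ModularForms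
  CongruenceSubgroup

variable (W W₂ : WeierstrassCurve ℚ) {V : VariableChange ℚ} (hV : V • W₂ = W.quadraticTwist 2)

include hV in
/-- **`W₂^{(−1)} ≅_ℚ W^{(−2)}`** for every `ℚ`-model `W₂` of `W^{(2)}`: explicitly `V′ • W₂^{(−1)} = W^{(−2)}` with
`V′ = (u, −r, 0, 0)` for `V = (u, r, s, t)`. [cite: SilvermanAEC2009, X.5 Cor. 5.4] -/
theorem exists_variableChange_smul_twistNegOne_eq :
    ∃ V' : VariableChange ℚ, V' • W₂.quadraticTwist (-1) = W.quadraticTwist (-2) := by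
  refine ⟨⟨V.u, (-1) * V.r, 0, 0⟩, ?_⟩
  rw [← quadraticTwist_smul, hV, quadraticTwist_quadraticTwist]
  norm_num

include hV in
/-- **`W₂` is in the (−1)-block iff `W` is in the (−2)-block**: `W₂^{(−1)}` is split multiplicative at `2` iff `W^{(−2)}` is.
[cite: SilvermanAEC2009, VII.5 Prop. 5.1 (b) and X.5 Cor. 5.4] -/
theorem hasSplitMultiplicativeReductionAtPrime_twistNegOne_model_iff [W₂.IsElliptic] :
    (W₂.quadraticTwist (-1)).HasSplitMultiplicativeReductionAtPrime 2 ↔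
      (W.quadraticTwist (-2)).HasSplitMultiplicativeReductionAtPrime 2 := by
  haveI : Fact (Nat.Prime 2) := ⟨Nat.prime_two⟩
  haveI : (W₂.quadraticTwist (-1)).IsElliptic := W₂.isElliptic_quadraticTwist (by norm_num)
  obtain ⟨V', hV'⟩ := exists_variableChange_smul_twistNegOne_eq W W₂ hV
  rw [← hV', hasSplitMultiplicativeReductionAtPrime_smul_iff]

include hV in
/-- **Same newform**: `f` is the newform of `W₂^{(−1)}` iff it is the newform of `W^{(−2)}` (the Dirichlet coefficients of
Mathlib's `WeierstrassCurve.LFunction` are `ℚ`-isomorphism invariants, `LFunction_smul`). [cite: SilvermanAEC2009, App. C §16] -/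
theorem isNewformOf_twistNegOne_model_iff [W₂.IsElliptic] {N : ℕ} [NeZero N] (f : CuspForm (Gamma0 N) 2) :
    IsNewformOf (W₂.quadraticTwist (-1)) f ↔ IsNewformOf (W.quadraticTwist (-2)) f := by
  haveI : (W₂.quadraticTwist (-1)).IsElliptic := W₂.isElliptic_quadraticTwist (by norm_num)
  obtain ⟨V', hV'⟩ := exists_variableChange_smul_twistNegOne_eq W W₂ hV
  rw [← hV']
  simp only [IsNewformOf, WeierstrassCurve.LFunction_smul]

include hV in
/-- **Irreducibility of `E[p]` passes to the model of the twist**: `W[p]` irreducible ⇒ `W₂[p]` irreducible (tree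
`hasIrreducibleModPGaloisRep_of_smul_eq_quadraticTwist_of_field`). [cite: SilvermanAEC2009, X.5 Cor. 5.4 and X.2 Prop. 2.4] -/
theorem hasIrreducibleModPGaloisRep_model {p : ℕ} (hirr : W.HasIrreducibleModPGaloisRep p) :
    W₂.HasIrreducibleModPGaloisRep p :=
  hasIrreducibleModPGaloisRep_of_smul_eq_quadraticTwist_of_field W W₂ two_ne_zero V hV hirr

include hV in
/-- … and conversely (`W` is a `ℚ`-model of `W₂^{(2)}`: `(W^{(2)})^{(2)} = W^{(4)} ≅ W`). [cite: SilvermanAEC2009, X.5 Cor. 5.4 and X.2 Prop. 2.4] -/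
theorem hasIrreducibleModPGaloisRep_model_iff {p : ℕ} :
    W₂.HasIrreducibleModPGaloisRep p ↔ W.HasIrreducibleModPGaloisRep p := by
  refine ⟨fun h ↦ ?_, hasIrreducibleModPGaloisRep_model W W₂ hV⟩
  -- `W` as a model of `W₂^{(2)}`
  obtain ⟨C₁, hC₁⟩ := W.exists_variableChange_quadraticTwist_one
  obtain ⟨C₂, hC₂⟩ := (W : WeierstrassCurve ℚ).exists_variableChange_quadraticTwist_mul_sq 1 (2 : ℚ) two_ne_zero
  have h4 : (C₂ * C₁) • W = (W.quadraticTwist 2).quadraticTwist 2 := by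
    rw [mul_smul, hC₁, hC₂, quadraticTwist_quadraticTwist]; norm_num
  rw [← hV, quadraticTwist_smul] at h4
  have hW : ((⟨V.u, 2 * V.r, 0, 0⟩ : VariableChange ℚ)⁻¹ * (C₂ * C₁)) • W = W₂.quadraticTwist 2 := by
    rw [mul_smul, h4, inv_smul_smul]
  exact hasIrreducibleModPGaloisRep_of_smul_eq_quadraticTwist_of_field W₂ W two_ne_zero _ hW h

end Summit.BirchSwinnertonDyer.BirchSwinnertonDyer.Theorems.AddSelmerTwistTwo

end
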